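import Mathlib.RingTheory.Polynomial.Eisenstein.Basic
import Mathlib.RingTheory.Polynomial.GaussLemma
import Mathlib.Algebra.Polynomial.Reverse
import Literature.NumberTheory.DiophantineGeometry.FunctionFieldGenusApproximationProofs
import HarnessLib

/-!
# Irreducibility of `Xⁿ - X - u` when `u` has a simple pole (Artin–Schreier polynomials)

Topic: `Literature/NumberTheory/DiophantineGeometry` (places of a field extension `F/K`,
`AlgFunctionField.PlaceOver`). For a place `P` of `F/K` and `u ∈ F` with `v_P(u) = -1`, the
polynomial `Xⁿ - X - u ∈ F[X]` is irreducible for every `n ≥ 2`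
(`irreducible_X_pow_sub_X_sub_C_of_ord_eq_neg_one`). For `n = q` a power of the characteristic this
is the first assertion of the theory of Artin–Schreier extensions [Stichtenoth 2009, Prop. 3.7.8 (a)
with `m_P = 1`; Prop. 3.7.10 (a)], and it is the form in which the Garcia–Stichtenoth tower
`x_{i+1}^q - x_{i+1} = x_i^q/(1 - x_i^{q-1})` [Stichtenoth 2009, Def. 7.4.1, Lemma 7.4.3] is shown to
consist of extensions of degree exactly `q` (the right hand side has a simple pole at the pole of
`x_i`). The book proves (a) through ramification (`e = q` forces `[F' : F] = q`); here we give the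
elementary proof by **Eisenstein's criterion applied to the reversed polynomial**: with `c = u⁻¹`
(`v_P(c) = 1`), `Xⁿ + cXⁿ⁻¹ - c ∈ 𝒪_P[X]` is Eisenstein at `P`, hence irreducible over
`F = Frac 𝒪_P` (Gauss's lemma, `𝒪_P` is integrally closed), and `(Xⁿ - X - u)^rev = -u · (Xⁿ + cXⁿ⁻¹ - c)`.
No hypothesis on the characteristic or on `n` beyond `n ≥ 2` is needed, and `F/K` need not be a
function field.

## Contents

* `reverse_X_pow_sub_X_sub_C` : `(Xⁿ - X - u)^rev = 1 - Xⁿ⁻¹ - uXⁿ` (`n ≥ 2`).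
* `irreducible_of_irreducible_reverse` : over a field, a polynomial with non-zero constant
  coefficient is irreducible if its reverse is.
* `irreducible_X_pow_sub_X_sub_C_of_ord_eq_neg_one` : the theorem.

## References

* H. Stichtenoth, *Algebraic Function Fields and Codes*, 2nd ed., GTM 254, Springer 2009:
  Prop. 3.7.8 (a), Prop. 3.7.10 (a), Lemma 7.4.3. [Stichtenoth2009]
-/

noncomputable section

open Polynomial

namespace Literature.NumberTheory.DiophantineGeometry.AlgFunctionField

universe u v

/-! ### The polynomials `Xⁿ - X - u` and their reversals -/

section Reverse

variable {R : Type*} [CommRing R]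

/-- `Xⁿ - X - u` has degree `n` for `n ≥ 2` (over a nontrivial ring). [folklore] -/
theorem natDegree_X_pow_sub_X_sub_C [Nontrivial R] (u : R) {n : ℕ} (hn : 2 ≤ n) :
    (X ^ n - X - C u : R[X]).natDegree = n := by
  have h1 : (X ^ n - X : R[X]).natDegree = n := by
    rw [natDegree_sub_eq_left_of_natDegree_lt]
    · simp
    · rw [natDegree_X, natDegree_X_pow]; omega
  rw [natDegree_sub_eq_left_of_natDegree_lt]
  · exact h1
  · simp only [natDegree_C, h1]; omega

/-- `Xⁿ - X - u` is monic for `n ≥ 2`. [folklore] -/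
theorem monic_X_pow_sub_X_sub_C (u : R) {n : ℕ} (hn : 2 ≤ n) :
    (X ^ n - X - C u : R[X]).Monic := by
  nontriviality R
  rw [Monic, leadingCoeff, natDegree_X_pow_sub_X_sub_C u hn]
  simp only [coeff_sub, coeff_X_pow, if_true, coeff_X, coeff_C]
  rw [if_neg (by omega), if_neg (by omega)]; ring

/-- The constant coefficient of `Xⁿ - X - u` is `-u` (`n ≥ 2`). [folklore] -/
theorem coeff_zero_X_pow_sub_X_sub_C (u : R) {n : ℕ} (hn : 2 ≤ n) :
    (X ^ n - X - C u : R[X]).coeff 0 = -u := by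
  simp only [coeff_sub, coeff_X_pow, coeff_X_zero, coeff_C_zero, sub_zero]
  rw [if_neg (by omega)]; ring

/-- **Reversal**: `(Xⁿ - X - u)^rev = 1 - Xⁿ⁻¹ - u Xⁿ` for `n ≥ 2`. [folklore] -/
theorem reverse_X_pow_sub_X_sub_C [Nontrivial R] (u : R) {n : ℕ} (hn : 2 ≤ n) :
    (X ^ n - X - C u : R[X]).reverse = 1 - X ^ (n - 1) - C u * X ^ n := by
  have hX : reflect n (X : R[X]) = X ^ (n - 1) := by
    rw [← pow_one (X : R[X]), reflect_monomial, revAt_le (by omega : 1 ≤ n), pow_one]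
  rw [reverse, natDegree_X_pow_sub_X_sub_C u hn, reflect_sub, reflect_sub, reflect_C,
    reflect_monomial, revAt_le le_rfl, Nat.sub_self, pow_zero, hX]

/-- Over a field, a polynomial with non-zero constant coefficient whose reverse is irreducible is
itself irreducible: a factorisation `f = a b` reverses to `f^rev = a^rev b^rev` with
`deg a^rev = deg a`, `deg b^rev = deg b` (the constant coefficients of `a`, `b` are non-zero).
[folklore] -/
theorem irreducible_of_irreducible_reverse {L : Type*} [Field L] {f : L[X]} (hf0 : f.coeff 0 ≠ 0)
    (h : Irreducible f.reverse) : Irreducible f := by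
  have key : ∀ a : L[X], a.coeff 0 ≠ 0 → IsUnit a.reverse → IsUnit a := by
    intro a ha hu
    have h1 := natDegree_eq_zero_of_isUnit hu
    rw [reverse_natDegree, natTrailingDegree_eq_zero_of_constantCoeff_ne_zero ha,
      Nat.sub_zero] at h1
    rw [eq_C_of_natDegree_eq_zero h1]
    exact isUnit_C.2 (Ne.isUnit (by rwa [← h1] at ha ⊢))
  refine ⟨fun hu => h.not_isUnit ?_, fun a b hab => ?_⟩
  · obtain ⟨r, hr, rfl⟩ := Polynomial.isUnit_iff.1 hu
    rw [reverse_C]; exact isUnit_C.2 hr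
  · have hab0 : a.coeff 0 * b.coeff 0 ≠ 0 := by rwa [← mul_coeff_zero, ← hab]
    have hrev : f.reverse = a.reverse * b.reverse := by rw [hab, reverse_mul_of_domain]
    rcases h.isUnit_or_isUnit hrev with ha | hb
    · exact Or.inl (key a (left_ne_zero_of_mul hab0) ha)
    · exact Or.inr (key b (right_ne_zero_of_mul hab0) hb)

end Reverse

/-! ### Eisenstein at a place -/

section Place

variable {K : Type u} {F : Type v} [Field K] [Field F] [Algebra K F]

namespace PlaceOver

/-- `v_P(x) ≠ 0` forces `x ≠ 0` (the junk value is `v_P(0) = 0`). [folklore] -/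
theorem ne_zero_of_ord_ne_zero (P : PlaceOver K F) {x : F} (h : P.ord x ≠ 0) : x ≠ 0 := by
  rintro rfl
  apply h
  rw [PlaceOver.ord, dif_pos (zero_mem _)]
  change ((IsDiscreteValuationRing.addVal _ (0 : P.toValuationSubring)).toNat : ℤ) = 0
  rw [IsDiscreteValuationRing.addVal_zero, ENat.toNat_top, Nat.cast_zero]

/-- An element of order `1` lies in the maximal ideal of `𝒪_P` but not in its square. [folklore] -/
theorem mem_maximalIdeal_and_not_mem_sq_of_ord_eq_one (P : PlaceOver K F) {c : F}
    (hc : P.ord c = 1) (hcO : c ∈ P.toValuationSubring) :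
    (⟨c, hcO⟩ : P.toValuationSubring) ∈ IsLocalRing.maximalIdeal P.toValuationSubring ∧
      (⟨c, hcO⟩ : P.toValuationSubring) ∉ (IsLocalRing.maximalIdeal P.toValuationSubring) ^ 2 := by
  have hc0 : c ≠ 0 := P.ne_zero_of_ord_ne_zero (by rw [hc]; exact one_ne_zero)
  refine ⟨?_, fun hmem => ?_⟩
  · rw [ValuationSubring.valuation_lt_one_iff]
    exact (P.valuation_lt_one_iff_ord_pos hc0).2 (by omega)
  · rw [(IsDiscreteValuationRing.irreducible_iff_uniformizer _).1 P.irreducible_uniformizer,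
      Ideal.span_singleton_pow, Ideal.mem_span_singleton] at hmem
    obtain ⟨d, hd⟩ := hmem
    have hd' : c = (P.uniformizer : F) ^ 2 * (d : F) := by
      have := congrArg (fun z : P.toValuationSubring => (z : F)) hd
      simpa using this
    have hd0 : (d : F) ≠ 0 := by
      rintro h0; rw [h0, mul_zero] at hd'; exact hc0 hd'
    have h2 := P.ord_nonneg_of_mem d.2
    rw [hd', P.ord_mul_eq (pow_ne_zero _ P.coe_uniformizer_ne_zero) hd0,
      P.ord_pow P.coe_uniformizer_ne_zero, P.ord_uniformizer_eq_one] at hc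
    omega

/-- **`Xⁿ + cXⁿ⁻¹ - c` is irreducible over `F` when `v_P(c) = 1`** (Eisenstein's criterion in
`𝒪_P[X]` at the maximal ideal of `𝒪_P`, then Gauss's lemma for the integrally closed domain `𝒪_P`
with fraction field `F`). [folklore] -/
theorem irreducible_X_pow_add_C_mul_X_pow_sub_C_of_ord_eq_one (P : PlaceOver K F) {c : F}
    (hc : P.ord c = 1) {n : ℕ} (hn : 2 ≤ n) :
    Irreducible (X ^ n + C c * X ^ (n - 1) - C c : F[X]) := by
  have hc0 : c ≠ 0 := P.ne_zero_of_ord_ne_zero (by rw [hc]; exact one_ne_zero)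
  have hcO : c ∈ P.toValuationSubring := (P.mem_toValuationSubring_iff_ord_nonneg hc0).2 (by omega)
  set O := P.toValuationSubring with hO
  set c' : O := ⟨c, hcO⟩ with hc'
  obtain ⟨hm, hm2⟩ := P.mem_maximalIdeal_and_not_mem_sq_of_ord_eq_one hc hcO
  set g : O[X] := X ^ n + C c' * X ^ (n - 1) - C c' with hg
  have hXn : (X ^ n + C c' * X ^ (n - 1) : O[X]).natDegree = n := by
    rw [natDegree_add_eq_left_of_natDegree_lt] <;> rw [natDegree_X_pow]
    exact (natDegree_C_mul_le _ _).trans_lt (by rw [natDegree_X_pow]; omega)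
  have hgdeg : g.natDegree = n := by
    rw [hg, natDegree_sub_eq_left_of_natDegree_lt] <;> rw [hXn]
    rw [natDegree_C]; omega
  have hgmonic : g.Monic := by
    rw [Monic, leadingCoeff, hgdeg, hg]
    simp only [coeff_sub, coeff_add, coeff_X_pow, if_true, coeff_C_mul, coeff_C]
    rw [if_neg (by omega), if_neg (by omega)]; ring
  have hcoeff : ∀ k < n, g.coeff k = if k = n - 1 then (if k = 0 then 0 else c') else
      (if k = 0 then -c' else 0) := by
    intro k hk
    simp only [hg, coeff_sub, coeff_add, coeff_X_pow, coeff_C_mul, coeff_C]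
    rw [if_neg (by omega)]
    split_ifs <;> ring
  have heis : g.IsEisensteinAt (IsLocalRing.maximalIdeal O) := by
    refine ⟨?_, fun {k} hk => ?_, ?_⟩
    · rw [hgmonic.leadingCoeff]
      exact (IsLocalRing.maximalIdeal.isMaximal O).ne_top ∘ (Ideal.eq_top_of_isUnit_mem _ · isUnit_one)
    · rw [hgdeg] at hk
      rw [hcoeff k hk]
      split_ifs
      · exact zero_mem _
      · exact hm
      · exact neg_mem hm
      · exact zero_mem _
    · rw [hcoeff 0 (by omega), if_neg (by omega), if_pos rfl]
      rwa [neg_mem_iff]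
  have hirr : Irreducible g :=
    heis.irreducible inferInstance hgmonic.isPrimitive (by rw [hgdeg]; omega)
  have := (hgmonic.irreducible_iff_irreducible_map_fraction_map (K := F)).1 hirr
  simpa [hg, Polynomial.map_sub, Polynomial.map_add, Polynomial.map_pow, Polynomial.map_mul] using this

/-- **Irreducibility of `Xⁿ - X - u` for `v_P(u) = -1`** (`n ≥ 2`; for `n = q = char^s` this is
[Stichtenoth 2009, Prop. 3.7.10 (a)] in the case of a simple pole, the case used for the
Garcia–Stichtenoth tower, Lemma 7.4.3): with `c = u⁻¹`, `(Xⁿ - X - u)^rev = -u (Xⁿ + cXⁿ⁻¹ - c)` is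
irreducible by the previous theorem, and irreducibility passes back to `Xⁿ - X - u` (constant
coefficient `-u ≠ 0`). [cite: Stichtenoth2009, Prop. 3.7.10 (a) and Lemma 7.4.3] -/
theorem irreducible_X_pow_sub_X_sub_C_of_ord_eq_neg_one (P : PlaceOver K F) {u : F}
    (hu : P.ord u = -1) {n : ℕ} (hn : 2 ≤ n) : Irreducible (X ^ n - X - C u : F[X]) := by
  have hu0 : u ≠ 0 := P.ne_zero_of_ord_ne_zero (by rw [hu]; norm_num)
  have hc : P.ord u⁻¹ = 1 := by rw [P.ord_inv hu0, hu]; rfl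
  have hirr := P.irreducible_X_pow_add_C_mul_X_pow_sub_C_of_ord_eq_one hc hn
  refine irreducible_of_irreducible_reverse (by rw [coeff_zero_X_pow_sub_X_sub_C u hn]; simpa) ?_
  rw [reverse_X_pow_sub_X_sub_C u hn]
  have hunit : IsUnit (C (-u) : F[X]) := isUnit_C.2 (Ne.isUnit (neg_ne_zero.2 hu0))
  have heq : (1 - X ^ (n - 1) - C u * X ^ n : F[X]) =
      C (-u) * (X ^ n + C u⁻¹ * X ^ (n - 1) - C u⁻¹) := by
    simp only [mul_sub, mul_add, ← mul_assoc, ← C_mul, neg_mul, mul_inv_cancel₀ hu0, map_neg,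
      map_one]
    ring
  rw [heq]
  exact (irreducible_isUnit_mul hunit).2 hirr

end PlaceOver

end Place

end Literature.NumberTheory.DiophantineGeometry.AlgFunctionField
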